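import Summits.QuantumFields.YangMills.Theorems.AlphaInputsT3ACv3XsClassSelector
import Summits.QuantumFields.YangMills.Theorems.AlphaInputsT3ACv3RegionalThm1Carrier
import HarnessLib

/-!
# `AlphaInputsT3ACv3InClassSelXsOfNestedRegularR7` — B1 EDGES-A v2: THE IN-CLASS SELECTION ROW `InClassSelT3Xs` FROM PRINT'S **PINNED NESTED-REGULAR MINIMISER
# STRUCTURE OVER JOINTLY (7)-REGULAR DATA** — the (R2) re-cut of the B1 display (★★OWNER RULING №24, LEAD L-R3∕L-R6), by name; cell `ym3-torus`, crux
# stmt-QuantumFields-19936 (`HistoryTailL`, (O‴χₛ) block B1), LEAD pen `ym-ust-19936-w1` (g4) on ★w2-19936 g6's spec memo «B1 STATEMENT SPEC» (19936 evidence #47)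

WHY A v2.  The v1 display ✓`AlphaInputsT3AC.NestedRegularSelT3` (this lineage, p613254) is VACUOUS AS TYPED for `K ≥ K₀` (★w6-19936 g3, 19936 evidence #49; LEAD L-R3):
it asks, for EVERY top datum `W` (vortex data included), frozen data `𝓥` with nested regularity (2) — whose level-`0` clause is GLOBAL since `Ω₀(h) = T` — and the exact
top constraint (3ᵗ), which a vortex around a recorded tube contradicts by Stokes.  Print asks its Theorem 1 only for data that are JOINTLY (7)-regular ([Balaban1985Variational]
(7) p.278 incl. the cross-boundary plaquettes read through one-step averages), and PINS the minimiser by the multi-level constraint (3) ([Balaban1985UV3] (42) p.266, all levels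
incl. `Λ₀ = Ω₁ᶜ`).  THIS FILE types exactly that (two edits to v1, NO new letter beyond the data set, memo #47 (E1)–(E2)):
* §1 `AlphaInputsT3AC.data7Set k h ε₁` — the (7)-SET `𝒟₇(k,h)` of multi-level data: (D0) the closed small-(0.4)-loop guard `dist1 (loopHol (𝓥 j) c x) ≤ δ∕2` below the top
  (so that `𝒟₇` is CLOSED: ★w2-19936 g6's (C1)), (D1) print's (7) for the cross-boundary datum (`RegionalVP.Reg7On`'s text read with `≤`, level-dependent radii `ε₁ j`) and (D2)
  recorded-largeness (ζ) of the level-`j` datum at every recorded plaquette `p ∈ P_j(h)` (`eps1Of j ≤ dist1`) — every letter is the carrier's ✓p612209 (`datumAt`, `cornerSet`,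
  `Omega`, `lam42`) or [Balaban1987RG1] (0.4)'s `BlockAveraging.loopHol`.
* §2 the display `AlphaInputsT3AC.NestedRegularSelT3R7 K ε₁ Ut UkH` (hypothesis schema, never asserted): pin-at-`triv`, measurability, and at every admissible non-trivial
  `(k, h)` and every `W`: OFF the (7)-set (no `𝓥 ∈ 𝒟₇(k,h)` with `𝓥 k = W`) just `UkH k h W ∈ 𝒞_Xs(k,h,W)` (a free measurable point — inhabited: ✓`exists_inClassSelT3Xs_of_sizes`,
  L-R4 (2) certificate); ON it: radii `α` in the record's windows (VERBATIM v1 (w)), data `𝓥 ∈ 𝒟₇(k,h)` with `𝓥 k = W`, nested regularity (2) on every `Ω_i(h)` at radius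
  `α_i·L^{−2i}`, and THE PINNING (3) `RegionalVP.ConstraintOn (blockAvg ℰp) k (lam42 Ω(h) k) 𝓥 (UkH k h W)` — print's own object; (3ʳ), (ζ) and (3ᵗ) of v1 are DERIVED.
* §3 the knit: `mem_adaptedClassT3Xs_of_constraintOn_data7` (one history, one datum: (2) + (3) + `𝓥 ∈ 𝒟₇` ⟹ `∈ 𝒞_Xs`, through v1's ✓`mem_adaptedClassT3Xs_of_nestedRegular` with
  (3ʳ) read off (3) at the four bonds of a recorded plaquette — ✓`mem_plaqsIn_lam42_of_mem_hist` + ✓`mem_bondsIn_of_mem_plaqsIn` + ✓`bondsIn_subset_bondsOn` — and (3ᵗ) off (3)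
  at the top level via ✓`lam42_self`) and ★★★ `inClassSelT3Xs_of_nestedRegularSelR7 (hM₁) : NestedRegularSelT3R7 … → InClassSelT3Xs …`.
SCOPE (memo #47 S1, option (R-Ω-2) of record): the carrier's level-`0` region is `Omega … 0 = univ`, so (D1)∕(2) at level `0` read ALL of `Λ₀ = Ω₁ᶜ`, where print regularises only
the collar `Ω₀ ⊋ Ω₁` and PINS the rest; under the lane's bookkeeping (frozen data = the supplier's choice) this is met by choosing the level-`0` datum inside the window at `P₀`
— a scope restriction on `π_k(𝒟₇)`, not an obstruction; no `Omega0Collar` letter is introduced here.  THE RADII `ε₁` ARE MEANT θ-SMALL (★alpha-2 g10's located caveat, display-owner review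
11:39Z): above the recording floor — `eps1Of j < ε₁ j`, so that `𝒟₇(k,h) ≠ ∅` and the on-clause is not escaped — and below the (w)-windows∕`B₃` (Thm-1 serviceability forces
`α_i = B₃·(data radius)` into `α₀ ≤ C68·θ(K)`, `2L²α_{i−1} ≤ C68·θ(K−i)` anyway); an O(1) `ε₁` ([Balaban1985Variational]'s constant) would re-admit the V4 tube vortex to `π_k(𝒟₇)`
(clause (2) at `i = 0` is global, `Ω₀ = T`) and make the on-clause contradictory there for `K ≥ K₀` by ★w6-19936 g3's witness — so consumers bind `ε₁` existentially per family
with the floor, never to a print constant.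
WHAT EDGES-B THEN READS (not this file; ★w6-19936 g4 LOCATE «nested-minimiser transport», ★w2-19936 g6 (C1)–(C3)): `NestedRegularSelT3R7 ⇐` [Balaban1985Variational] Thm 1 at the
regional members `famRegT3` (✓p612209) at every level of the same history — `B11Thm1.Thm1At` — through LQB ✓`B10Eq68TorusRegularity.regAt_of_crit_nested` (nested criticality,
[Balaban1985UV3] p.267 l.1–3) + ✓`FrozenSelection.exists_frozenSelector` + ✓`exists_measurable_argmin_closedClass` + closedness of `𝒟₇` and of the regional regular fibre.
HONEST FRAMING.  Plumbing and one definition of a SET of data; `NestedRegularSelT3R7` is a HYPOTHESIS SCHEMA standing for print's Theorem 1 output at the regional carrier, NOT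
proved; the stub `stub_laneRecordsV4Chi`, the crux `HistoryTailL`, NODE O d = 3 and any gap are NOT claimed; count-neutral helper (`--supports stmt-QuantumFields-19936`); registry
untouched.  YM₃ on the three-torus is rung R3 of the programme, NOT the Clay problem: nothing here bears on d = 4, infinite volume, or a mass gap.

References: T. Bałaban, Commun. Math. Phys. 102 (1985) 277–309 [Balaban1985Variational] ((2)–(4) p.278, (7) p.278, Thm 1 (8) p.279); Commun. Math. Phys. 102 (1985) 255–275
[Balaban1985UV3] ((7) p.257, (40)–(42) p.266, p.267 l.1–3, (67)–(68) p.273); Commun. Math. Phys. 98 (1985) 17–51 [Balaban1985Averaging] (Prop 2 (52)–(54) p.26).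
-/

set_option autoImplicit false

noncomputable section

namespace Summit.QuantumFields.YangMills.Theorems

open MeasureTheory Set
open scoped Matrix.Norms.L2Operator
open Literature.MathematicalPhysics.QuantumFieldTheory.Balaban1983to89
open Literature.MathematicalPhysics.QuantumFieldTheory.Balaban1983to89.T3ContinuumYM3Torus
open Literature.MathematicalPhysics.QuantumFieldTheory.Balaban1983to89.T3UnitLawDensityEML (ℰp)
open Literature.MathematicalPhysics.QuantumFieldTheory.Balaban1983to89.T3UnitScaleTilt (θBal)
open Literature.MathematicalPhysics.QuantumFieldTheory.Balaban1983to89.ExpMeanLog (deltaSU)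
open Literature.MathematicalPhysics.QuantumFieldTheory.Balaban1983to89.B10 (pFun)
open Literature.MathematicalPhysics.QuantumFieldTheory.Balaban1983to89.B10Eq38TorusDomains (toFine cornerSet plaqsIn mem_plaqsIn_iff)
open Literature.MathematicalPhysics.QuantumFieldTheory.Balaban1983to89.B10Eq42TorusConstraint
  (bondsIn lam42 lam42_self lam42_of_lt mem_bondsIn_of_mem_plaqsIn)
open Literature.MathematicalPhysics.QuantumFieldTheory.Balaban1985CMP102.Setting
open Summit.QuantumFields.Balaban3D.Carriers
open Summit.QuantumFields.Balaban3D.Proofs.Primitives (AlphaConsts)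
open Summit.QuantumFields.YangMills.Theorems.RegionalVP

/-! ## §1 The (7)-set `𝒟₇(k,h)` of jointly (7)-regular, recorded-large multi-level data -/

section Defs

variable (F : T3Family) (𝔠 : AlphaConsts F.L (suGroupModel 2).N) (γ : ℝ) (hγ : 0 < γ) (hγ1 : γ ≤ (min 𝔠.gamma0 1) ^ 2) (K : ℕ)

/-- **THE (7)-SET `𝒟₇(k,h)`** of multi-level data `𝓥 = (𝓥_j)_j` for the history `h` of level `k` (levels `> k` unread): (D0) SMALL (0.4)-LOOPS of every datum below the top,
`dist1 (loopHol (𝓥 j) c x) ≤ δ∕2` for all coarse bonds `c` (`j < k`) — the closed guard on which the one-step average `blockAvg ℰp` read by the cross-boundary datum is the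
unguarded, CONTINUOUS step (`isClosed_smallAll`, `avg_eq_rawAvg_of_small`, `continuousOn_rawAvg_eval`; it makes `𝒟₇` CLOSED — the measurable-selection input of EDGES-B — and
costs print nothing: its data are (7)-small where read and free, hence flattenable, where unread); (D1) PRINT'S (7) READ WITH `≤` AT LEVEL-DEPENDENT RADII —
for every `j ≤ k` and every plaquette `p′` of `T^{(j)}` with a corner in `Λ_j(h)` and (below the top level) no corner in `Ω_{j+1}(h)`, the cross-boundary datum
(`RegionalVP.datumAt`: at level `0` the datum itself, at level `j+1` the datum on `Λ_{j+1}` and the one-step `ℰp`-average of the finer datum elsewhere) has `dist1 (∂𝓥(p′)) ≤ ε₁ j`;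
(D2) RECORDED-LARGENESS (ζ of (7)∕(40)) — at every recorded plaquette `p ∈ P_j(h)`, `j < k`, `eps1Of j ≤ dist1 (∂𝓥_j(p))`.  The data for which [Balaban1985Variational] Thm 1 is
asked (D1) and whose recording the history asserts (D2).  The radii `ε₁ j` are meant θ-SMALL (recording floor `eps1Of j < ε₁ j`, below the record's windows); see the
file header. [cite: Balaban1985Variational, (7) p.278; Balaban1985UV3, (7) p.257, (40) p.266] -/
def AlphaInputsT3AC.data7Set (k : ℕ) (h : Hist (F.P K) k) (ε₁ : ℕ → ℝ) :
    Set ((j : ℕ) → GaugeField (F.P K) j (Matrix.specialUnitaryGroup (Fin 2) ℂ)) :=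
  {𝓥 | (∀ j, j < k → ∀ (c : PBond (F.P K) (j + 1)) (x : BlockAveraging.Idx (F.P K)),
        GaugeGroup.dist1 (BlockAveraging.loopHol (𝓥 j) c x) ≤ ℰp.δ / 2) ∧
      (∀ j, j ≤ k → ∀ p : Plaq (F.P K) j,
        (cornerSet j p ∩ lam42 (Omega 𝔠.lane.carrier.M₁ (rcolOf (T3Scales F γ hγ (hγ1.trans (sq_min_one_le _ 𝔠.gamma0_pos)) K) 𝔠.lane.carrier) k h) k j).Nonempty →
        (j < k → cornerSet j p ∩ Omega 𝔠.lane.carrier.M₁ (rcolOf (T3Scales F γ hγ (hγ1.trans (sq_min_one_le _ 𝔠.gamma0_pos)) K) 𝔠.lane.carrier) k h (j + 1) = ∅) →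
        GaugeGroup.dist1 (GaugeField.plaqHol
          (datumAt (fun i => BlockAveraging.blockAvg (P := F.P K) (j := i) ℰp)
            (lam42 (Omega 𝔠.lane.carrier.M₁ (rcolOf (T3Scales F γ hγ (hγ1.trans (sq_min_one_le _ 𝔠.gamma0_pos)) K) 𝔠.lane.carrier) k h) k) 𝓥 j) p) ≤ ε₁ j) ∧
      (∀ (j : Fin k) (p : Plaq (F.P K) j), p ∈ h j →
        eps1Of (T3Scales F γ hγ (hγ1.trans (sq_min_one_le _ 𝔠.gamma0_pos)) K) 𝔠.lane.carrier j ≤ GaugeGroup.dist1 (GaugeField.plaqHol (𝓥 j) p))}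

/-! ## §2 The display: print's pinned nested-regular minimiser structure over the (7)-set, a free class point off it -/

/-- **NESTED-REGULAR PINNED SELECTION OVER JOINTLY (7)-REGULAR DATA — the B1 display, v2 (R7)** (hypothesis schema, never asserted; what EDGES-B proves of print's (42)-minimiser
map): a family `UkH k h : SU(2)^{bonds_k} → SU(2)^{bonds_0}` PINNED to `Ut` at the trivial history and MEASURABLE, such that at every ADMISSIBLE non-trivial history `h` of level
`k ≤ K` and every top datum `W`: (off) if NO `𝓥 ∈ 𝒟₇(k,h)` has `𝓥 k = W` (e.g. vortex data), `UkH k h W` is just a point of the one-currency class `𝒞_Xs(k,h,W)`; (on) otherwise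
there are radii `α` in the record's windows ((w) VERBATIM as in v1 ✓`NestedRegularSelT3`: [Balaban1985Averaging] Prop 2 smallness, `α₀ ≤ C68·θ(K)`, `2L²α_{i−1} ≤ C68·θ(K−i)`,
`α_j ≤ ½C68·g_jp(g_j)`) and data `𝓥 ∈ 𝒟₇(k,h)` with `𝓥 k = W` such that `UkH k h W` has NESTED REGULARITY (2) — every fine plaquette with corners in `Ω_i(h)` within `α_i·L^{−2i}`
of `1`, `i ≤ k` ([Balaban1985UV3] p.267 l.1–3) — and satisfies THE MULTI-LEVEL CONSTRAINT (3) `Ūʲ = 𝓥_j` on `Λ_j(h)` for EVERY `j ≤ k`, `Λ₀ = Ω₁ᶜ` included ([Balaban1985UV3] (42)).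
[cite: Balaban1985Variational, (2)–(3) p.278, (7) p.278, Thm 1 (8) p.279; Balaban1985UV3, (42) p.266, p.267, (67)–(68) p.273] -/
def AlphaInputsT3AC.NestedRegularSelT3R7 (ε₁ : ℕ → ℝ)
    (Ut : (k : ℕ) → GaugeField (F.P K) k (Matrix.specialUnitaryGroup (Fin 2) ℂ) → GaugeField (F.P K) 0 (Matrix.specialUnitaryGroup (Fin 2) ℂ))
    (UkH : (k : ℕ) → Hist (F.P K) k → GaugeField (F.P K) k (Matrix.specialUnitaryGroup (Fin 2) ℂ) →
      GaugeField (F.P K) 0 (Matrix.specialUnitaryGroup (Fin 2) ℂ)) : Prop :=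
  (∀ k, UkH k (Hist.triv (F.P K) k) = Ut k) ∧
  (∀ (k : ℕ) (h : Hist (F.P K) k), Measurable (UkH k h)) ∧
  (∀ (k : ℕ), k ≤ K → ∀ (h : Hist (F.P K) k),
    Hist.Admissible 𝔠.lane.carrier.M₁ (rcolOf (T3Scales F γ hγ (hγ1.trans (sq_min_one_le _ 𝔠.gamma0_pos)) K) 𝔠.lane.carrier) k h →
    h ≠ Hist.triv (F.P K) k →
    ∀ (W : GaugeField (F.P K) k (Matrix.specialUnitaryGroup (Fin 2) ℂ)),
      -- (off) no jointly (7)-regular recorded-large extension of `W`: a free point of the class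
      ((¬ ∃ 𝓥 : (j : ℕ) → GaugeField (F.P K) j (Matrix.specialUnitaryGroup (Fin 2) ℂ),
          𝓥 ∈ AlphaInputsT3AC.data7Set F 𝔠 γ hγ hγ1 K k h ε₁ ∧ 𝓥 k = W) →
        UkH k h W ∈ AlphaInputsT3AC.adaptedClassT3Xs F 𝔠 γ hγ hγ1 K k h W) ∧
      -- (on) print's pinned nested-regular minimiser structure
      ((∃ 𝓥 : (j : ℕ) → GaugeField (F.P K) j (Matrix.specialUnitaryGroup (Fin 2) ℂ),
          𝓥 ∈ AlphaInputsT3AC.data7Set F 𝔠 γ hγ hγ1 K k h ε₁ ∧ 𝓥 k = W) →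
        ∃ (α : ℕ → ℝ) (𝓥 : (j : ℕ) → GaugeField (F.P K) j (Matrix.specialUnitaryGroup (Fin 2) ℂ)),
          𝓥 ∈ AlphaInputsT3AC.data7Set F 𝔠 γ hγ hγ1 K k h ε₁ ∧ 𝓥 k = W ∧
          -- (w) the radii and the record's windows (verbatim v1)
          (∀ i, i ≤ k → 0 < α i) ∧
          (∀ i, i ≤ k → (143 * ((7 : ℝ) ^ 2 / 4) ^ 2) * ((F.L : ℝ) ^ 2 * α i) ≤ 1 / 3 ∧
            2 * ((F.L : ℝ) ^ 2 * α i) ≤ 2 * deltaSU (Fin 2) / ((7 * F.L : ℕ) : ℝ) ^ 2) ∧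
          α 0 ≤ 𝔠.C68 * θBal F.L γ 𝔠.b₀ 𝔠.p₀ K ∧
          (∀ i, 1 ≤ i → i ≤ k → 2 * ((F.L : ℝ) ^ 2 * α (i - 1)) ≤ 𝔠.C68 * θBal F.L γ 𝔠.b₀ 𝔠.p₀ (K - i)) ∧
          (∀ j, j ≤ k → α j ≤ 𝔠.C68 / 2 * ((T3Scales F γ hγ (hγ1.trans (sq_min_one_le _ 𝔠.gamma0_pos)) K).gk j *
            pFun 𝔠.lane.carrier.b₀ 𝔠.lane.carrier.p₀ ((T3Scales F γ hγ (hγ1.trans (sq_min_one_le _ 𝔠.gamma0_pos)) K).gk j))) ∧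
          -- (2) nested regularity on the regions at the level-dependent radii
          (∀ i, i ≤ k → PlaqSmallOn (↑(plaqsIn 0 (Omega 𝔠.lane.carrier.M₁
              (rcolOf (T3Scales F γ hγ (hγ1.trans (sq_min_one_le _ 𝔠.gamma0_pos)) K) 𝔠.lane.carrier) k h i)) : Set (Plaq (F.P K) 0))
              (α i * (((F.L : ℝ) ^ i)⁻¹) ^ 2) (UkH k h W)) ∧
          -- (3) the multi-level constraint, all levels `j ≤ k` (print's (42), `Λ₀ = Ω₁ᶜ` included)
          ConstraintOn (fun i => BlockAveraging.blockAvg (P := F.P K) (j := i) ℰp) k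
            (lam42 (Omega 𝔠.lane.carrier.M₁ (rcolOf (T3Scales F γ hγ (hγ1.trans (sq_min_one_le _ 𝔠.gamma0_pos)) K) 𝔠.lane.carrier) k h) k)
            𝓥 (UkH k h W)))

end Defs

/-! ## §3 The knit: (2) + (3) over the (7)-set ⇒ membership in `𝒞_Xs`; the display ⇒ `InClassSelT3Xs` -/

section Knit

variable {F : T3Family} {𝔠 : AlphaConsts F.L (suGroupModel 2).N} {γ : ℝ} {hγ : 0 < γ} {hγ1 : γ ≤ (min 𝔠.gamma0 1) ^ 2} {K : ℕ}

/-- Unfolding membership in the (7)-set. [cite: Balaban1985Variational, (7) p.278] -/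
theorem AlphaInputsT3AC.mem_data7Set_iff {k : ℕ} {h : Hist (F.P K) k} {ε₁ : ℕ → ℝ}
    {𝓥 : (j : ℕ) → GaugeField (F.P K) j (Matrix.specialUnitaryGroup (Fin 2) ℂ)} :
    𝓥 ∈ AlphaInputsT3AC.data7Set F 𝔠 γ hγ hγ1 K k h ε₁ ↔
      (∀ j, j < k → ∀ (c : PBond (F.P K) (j + 1)) (x : BlockAveraging.Idx (F.P K)),
        GaugeGroup.dist1 (BlockAveraging.loopHol (𝓥 j) c x) ≤ ℰp.δ / 2) ∧
      (∀ j, j ≤ k → ∀ p : Plaq (F.P K) j,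
        (cornerSet j p ∩ lam42 (Omega 𝔠.lane.carrier.M₁ (rcolOf (T3Scales F γ hγ (hγ1.trans (sq_min_one_le _ 𝔠.gamma0_pos)) K) 𝔠.lane.carrier) k h) k j).Nonempty →
        (j < k → cornerSet j p ∩ Omega 𝔠.lane.carrier.M₁ (rcolOf (T3Scales F γ hγ (hγ1.trans (sq_min_one_le _ 𝔠.gamma0_pos)) K) 𝔠.lane.carrier) k h (j + 1) = ∅) →
        GaugeGroup.dist1 (GaugeField.plaqHol
          (datumAt (fun i => BlockAveraging.blockAvg (P := F.P K) (j := i) ℰp)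
            (lam42 (Omega 𝔠.lane.carrier.M₁ (rcolOf (T3Scales F γ hγ (hγ1.trans (sq_min_one_le _ 𝔠.gamma0_pos)) K) 𝔠.lane.carrier) k h) k) 𝓥 j) p) ≤ ε₁ j) ∧
      (∀ (j : Fin k) (p : Plaq (F.P K) j), p ∈ h j →
        eps1Of (T3Scales F γ hγ (hγ1.trans (sq_min_one_le _ 𝔠.gamma0_pos)) K) 𝔠.lane.carrier j ≤ GaugeGroup.dist1 (GaugeField.plaqHol (𝓥 j) p)) :=
  Iff.rfl

/-- **(3) AT THE FOUR BONDS OF A RECORDED PLAQUETTE ⇒ (3ʳ)**: at an admissible history of level `k ≤ K`, if `U` satisfies the multi-level constraint (3) with data `𝓥`, then at every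
recorded plaquette `p ∈ P_j(h)`, `j < k`, the `j`-fold `ℰp`-average of `U` and the datum `𝓥 j` have the same plaquette variable — the four bonds of `p` lie in `Λ_j(h)`
(✓`mem_plaqsIn_lam42_of_mem_hist`, ✓`mem_bondsIn_of_mem_plaqsIn`, `bondsIn ⊆ bondsOn`). [cite: Balaban1985Variational, (3) p.278; Balaban1985UV3, p.273 L14] -/
theorem AlphaInputsT3AC.plaqHol_iter_eq_of_constraintOn {k : ℕ} (hk : k ≤ K) {h : Hist (F.P K) k}
    (hh : Hist.Admissible 𝔠.lane.carrier.M₁ (rcolOf (T3Scales F γ hγ (hγ1.trans (sq_min_one_le _ 𝔠.gamma0_pos)) K) 𝔠.lane.carrier) k h)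
    {𝓥 : (j : ℕ) → GaugeField (F.P K) j (Matrix.specialUnitaryGroup (Fin 2) ℂ)} {U : GaugeField (F.P K) 0 (Matrix.specialUnitaryGroup (Fin 2) ℂ)}
    (h3 : ConstraintOn (fun i => BlockAveraging.blockAvg (P := F.P K) (j := i) ℰp) k
      (lam42 (Omega 𝔠.lane.carrier.M₁ (rcolOf (T3Scales F γ hγ (hγ1.trans (sq_min_one_le _ 𝔠.gamma0_pos)) K) 𝔠.lane.carrier) k h) k) 𝓥 U)
    (j : Fin k) {p : Plaq (F.P K) j} (hp : p ∈ h j) :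
    GaugeField.plaqHol (Averaging.iter (fun l => BlockAveraging.blockAvg (P := F.P K) (j := l) ℰp) j U) p = GaugeField.plaqHol (𝓥 j) p := by
  have hin := AlphaInputsT3AC.mem_plaqsIn_lam42_of_mem_hist (hγ1 := hγ1) hk hh j hp
  obtain ⟨b1, b2, b3, b4⟩ := mem_bondsIn_of_mem_plaqsIn hin
  have e : ∀ b : PBond (F.P K) j, b ∈ bondsIn (j : ℕ) (lam42 (Omega 𝔠.lane.carrier.M₁
      (rcolOf (T3Scales F γ hγ (hγ1.trans (sq_min_one_le _ 𝔠.gamma0_pos)) K) 𝔠.lane.carrier) k h) k j) →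
      Averaging.iter (fun l => BlockAveraging.blockAvg (P := F.P K) (j := l) ℰp) j U b = 𝓥 j b :=
    fun b hb => h3 j (le_of_lt j.isLt) b (bondsIn_subset_bondsOn _ _ hb)
  unfold GaugeField.plaqHol
  rw [e _ b1, e _ b2, e _ b3, e _ b4]

/-- **(3) AT THE TOP LEVEL ⇒ (3ᵗ)**: the multi-level constraint with data `𝓥`, `𝓥 k = W`, gives the exact `k`-fold `ℰp`-averages `W` on the bonds of `Ω_k(h)` (`Λ_k = Ω_k`,
✓`lam42_self`; `bondsIn ⊆ bondsOn`). [cite: Balaban1985UV3, (42) p.266; Balaban1985Variational, (3) p.278] -/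
theorem AlphaInputsT3AC.iter_eq_of_constraintOn_top {k : ℕ} {h : Hist (F.P K) k}
    {𝓥 : (j : ℕ) → GaugeField (F.P K) j (Matrix.specialUnitaryGroup (Fin 2) ℂ)} {U : GaugeField (F.P K) 0 (Matrix.specialUnitaryGroup (Fin 2) ℂ)}
    {W : GaugeField (F.P K) k (Matrix.specialUnitaryGroup (Fin 2) ℂ)}
    (h3 : ConstraintOn (fun i => BlockAveraging.blockAvg (P := F.P K) (j := i) ℰp) k
      (lam42 (Omega 𝔠.lane.carrier.M₁ (rcolOf (T3Scales F γ hγ (hγ1.trans (sq_min_one_le _ 𝔠.gamma0_pos)) K) 𝔠.lane.carrier) k h) k) 𝓥 U)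
    (htop : 𝓥 k = W) :
    ∀ b : PBond (F.P K) k, b ∈ bondsIn k (Omega 𝔠.lane.carrier.M₁
        (rcolOf (T3Scales F γ hγ (hγ1.trans (sq_min_one_le _ 𝔠.gamma0_pos)) K) 𝔠.lane.carrier) k h k) →
      Averaging.iter (fun i => BlockAveraging.blockAvg (P := F.P K) (j := i) ℰp) k U b = W b := by
  intro b hb
  rw [← htop]
  refine h3 k le_rfl b ?_
  rw [lam42_self]
  exact bondsIn_subset_bondsOn k _ hb

/-- **ONE HISTORY, ONE DATUM ON THE (7)-SET: class membership from print's structure.**  At an admissible history `h` of level `k ≤ K`, a configuration `U` with nested regularity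
(2) at radii `α` in the record's windows and the multi-level constraint (3) against data `𝓥 ∈ 𝒟₇(k,h)` with `𝓥 k = W` lies in `𝒞_Xs(k,h,W)` — v1's ✓`mem_adaptedClassT3Xs_of_nestedRegular`
with (3ʳ) (`plaqHol_iter_eq_of_constraintOn`), (ζ) (= (D2) of `𝒟₇`) and (3ᵗ) (`iter_eq_of_constraintOn_top`) DERIVED. [cite: Balaban1985UV3, (42) p.266, (67)–(68) p.273; Balaban1985Variational, (3) p.278, Thm 1 (8) p.279] -/
theorem AlphaInputsT3AC.mem_adaptedClassT3Xs_of_constraintOn_data7 {k : ℕ} (hk : k ≤ K) {h : Hist (F.P K) k}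
    (hh : Hist.Admissible 𝔠.lane.carrier.M₁ (rcolOf (T3Scales F γ hγ (hγ1.trans (sq_min_one_le _ 𝔠.gamma0_pos)) K) 𝔠.lane.carrier) k h)
    (hM₁ : 7 * F.L + 3 ≤ 𝔠.M₁) {ε₁ : ℕ → ℝ} {W : GaugeField (F.P K) k (Matrix.specialUnitaryGroup (Fin 2) ℂ)}
    {U : GaugeField (F.P K) 0 (Matrix.specialUnitaryGroup (Fin 2) ℂ)} {α : ℕ → ℝ}
    {𝓥 : (j : ℕ) → GaugeField (F.P K) j (Matrix.specialUnitaryGroup (Fin 2) ℂ)}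
    (h7 : 𝓥 ∈ AlphaInputsT3AC.data7Set F 𝔠 γ hγ hγ1 K k h ε₁) (htop : 𝓥 k = W)
    (hα : ∀ i, i ≤ k → 0 < α i)
    (hsmall : ∀ i, i ≤ k → (143 * ((7 : ℝ) ^ 2 / 4) ^ 2) * ((F.L : ℝ) ^ 2 * α i) ≤ 1 / 3 ∧
      2 * ((F.L : ℝ) ^ 2 * α i) ≤ 2 * deltaSU (Fin 2) / ((7 * F.L : ℕ) : ℝ) ^ 2)
    (hwin0 : α 0 ≤ 𝔠.C68 * θBal F.L γ 𝔠.b₀ 𝔠.p₀ K)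
    (hwin : ∀ i, 1 ≤ i → i ≤ k → 2 * ((F.L : ℝ) ^ 2 * α (i - 1)) ≤ 𝔠.C68 * θBal F.L γ 𝔠.b₀ 𝔠.p₀ (K - i))
    (hρ : ∀ j, j ≤ k → α j ≤ 𝔠.C68 / 2 * ((T3Scales F γ hγ (hγ1.trans (sq_min_one_le _ 𝔠.gamma0_pos)) K).gk j *
      pFun 𝔠.lane.carrier.b₀ 𝔠.lane.carrier.p₀ ((T3Scales F γ hγ (hγ1.trans (sq_min_one_le _ 𝔠.gamma0_pos)) K).gk j)))
    (h2 : ∀ i, i ≤ k → PlaqSmallOn (↑(plaqsIn 0 (Omega 𝔠.lane.carrier.M₁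
        (rcolOf (T3Scales F γ hγ (hγ1.trans (sq_min_one_le _ 𝔠.gamma0_pos)) K) 𝔠.lane.carrier) k h i)) : Set (Plaq (F.P K) 0))
        (α i * (((F.L : ℝ) ^ i)⁻¹) ^ 2) U)
    (h3 : ConstraintOn (fun i => BlockAveraging.blockAvg (P := F.P K) (j := i) ℰp) k
      (lam42 (Omega 𝔠.lane.carrier.M₁ (rcolOf (T3Scales F γ hγ (hγ1.trans (sq_min_one_le _ 𝔠.gamma0_pos)) K) 𝔠.lane.carrier) k h) k) 𝓥 U) :
    U ∈ AlphaInputsT3AC.adaptedClassT3Xs F 𝔠 γ hγ hγ1 K k h W :=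
  AlphaInputsT3AC.mem_adaptedClassT3Xs_of_nestedRegular hk hh hM₁ hα hsmall hwin0 hwin hρ h2
    (fun j _ hp => AlphaInputsT3AC.plaqHol_iter_eq_of_constraintOn (hγ1 := hγ1) hk hh h3 j hp)
    (fun j p hp => h7.2.2 j p hp)
    (fun _ => AlphaInputsT3AC.iter_eq_of_constraintOn_top (hγ1 := hγ1) h3 htop)

/-- ★★★ **B1 EDGES-A v2 — THE IN-CLASS SELECTION ROW OVER `𝒞_Xs` FROM THE PINNED NESTED-REGULAR DISPLAY OVER THE (7)-SET, BY NAME** (the only record row displayed: the collar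
`7·F.L + 3 ≤ 𝔠.M₁`, a conjunct of every `PinnedPartsT3ACRec*`).  Off the (7)-set the display's free clause serves; on it `mem_adaptedClassT3Xs_of_constraintOn_data7`.
[cite: Balaban1985Variational, Thm 1 (8) p.279, (2)–(3) p.278, (7) p.278; Balaban1985UV3, (42) p.266, p.267, (67)–(68) p.273] -/
theorem AlphaInputsT3AC.inClassSelT3Xs_of_nestedRegularSelR7 (hM₁ : 7 * F.L + 3 ≤ 𝔠.M₁) {ε₁ : ℕ → ℝ}
    {Ut : (k : ℕ) → GaugeField (F.P K) k (Matrix.specialUnitaryGroup (Fin 2) ℂ) → GaugeField (F.P K) 0 (Matrix.specialUnitaryGroup (Fin 2) ℂ)}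
    {UkH : (k : ℕ) → Hist (F.P K) k → GaugeField (F.P K) k (Matrix.specialUnitaryGroup (Fin 2) ℂ) →
      GaugeField (F.P K) 0 (Matrix.specialUnitaryGroup (Fin 2) ℂ)}
    (hsel : AlphaInputsT3AC.NestedRegularSelT3R7 F 𝔠 γ hγ hγ1 K ε₁ Ut UkH) :
    AlphaInputsT3AC.InClassSelT3Xs F 𝔠 γ hγ hγ1 K Ut UkH := by
  obtain ⟨hpin, hmeas, hmem⟩ := hsel
  refine ⟨hpin, hmeas, fun k hk h hh hne W => ?_⟩
  obtain ⟨hoff, hon⟩ := hmem k hk h hh hne W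
  by_cases hW : ∃ 𝓥 : (j : ℕ) → GaugeField (F.P K) j (Matrix.specialUnitaryGroup (Fin 2) ℂ),
      𝓥 ∈ AlphaInputsT3AC.data7Set F 𝔠 γ hγ hγ1 K k h ε₁ ∧ 𝓥 k = W
  · obtain ⟨α, 𝓥, h7, htop, hα, hsmall, hwin0, hwin, hρ, h2, h3⟩ := hon hW
    exact AlphaInputsT3AC.mem_adaptedClassT3Xs_of_constraintOn_data7 hk hh hM₁ h7 htop hα hsmall hwin0 hwin hρ h2 h3
  · exact hoff hW

end Knit

end Summit.QuantumFields.YangMills.Theorems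

end
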